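import Summits.CriticalPhenomena.SAWScalingLimit.Theses.SAWPhaseRetrieval
import Summits.CriticalPhenomena.SAWScalingLimit.Theorems.SAWPhaseRetrievalRetrievalStabilityDiscAlgebra
import Summits.CriticalPhenomena.SAWScalingLimit.Theorems.SAWPhaseRetrievalRetrievalStabilityDiscTile1
import Summits.CriticalPhenomena.SAWScalingLimit.Theorems.SAWPhaseRetrievalRetrievalStabilityDiscTile2
import Literature.Probability.LatticeModels.TriangularLatticeProofs
import Literature.Barriers.CriticalPhenomena.ParafermionicHalfCauchyRiemann

/-!
# Retrieval stability, disc case — the rhombus tile, III: the boundary and the variance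

For the proof of `SAWPhaseRetrieval.RetrievalStabilityDisc` (stmt-CriticalPhenomena-11413).
The shoelace sum of the image of the tile boundary is at most `(√3 + 18ε)(1+7ε)² ℓ_D²` (the image
boundary is a near-parallelogram with near-straight sides of lengths within `7εℓ_D` of `ℓ_D`).
With part II this bounds the second moment `Σ λ² ≤ (2 + 100 ε) ℓ_D²` of the `2ρ²` values
`λ = ‖G‖` on the horizontal edges of the triangles of the tile, while part I bounds the first
moment from below, `Σ λ ≥ 2ρ(1-7ε) ℓ_D`; the variance about `s = ℓ_D/ρ` is therefore `O(ε) ℓ_D²`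
and Cauchy–Schwarz gives the TILE ESTIMATE `Σ |‖G e‖ - s| ≤ 50 √ε ρ² s` over all edges at the up
faces of the tile.
-/

namespace Summit.CriticalPhenomena.SAWScalingLimit.Theorems

open Literature.Probability.LatticeModels Literature.Probability.Percolation Complex Finset


/-! ### Shoelace sums along a near-straight side -/

/-- **Same-side terms.** If every `g k` is within `ε‖g k‖` of `‖g k‖` (`ε ≤ 1`), the shoelace terms
of the polygonal path with steps `g 0, g 1, …` against its own partial sums are small:
`|Σ_{k<n} Im (conj (Σ_{j<k} g j) · g k)| ≤ 3 ε (Σ_{k<n} ‖g k‖)²`. [folklore] -/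
theorem rsd_side_self_le (g : ℕ → ℂ) (n : ℕ) {ε : ℝ} (hε : 0 ≤ ε) (hε1 : ε ≤ 1)
    (hg : ∀ k, k < n → ‖g k - ((‖g k‖ : ℝ) : ℂ)‖ ≤ ε * ‖g k‖) :
    |∑ k ∈ range n, ((starRingEnd ℂ) (∑ j ∈ range k, g j) * g k).im| ≤
      3 * ε * (∑ k ∈ range n, ‖g k‖) ^ 2 := by
  have hL : ∀ k, k < n → ∑ j ∈ range k, ‖g j‖ ≤ ∑ j ∈ range n, ‖g j‖ := fun k hk =>
    Finset.sum_le_sum_of_subset_of_nonneg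
      (fun x hx => Finset.mem_range.2 ((Finset.mem_range.1 hx).trans hk))
      (fun _ _ _ => norm_nonneg _)
  have key : ∀ k ∈ range n, |((starRingEnd ℂ) (∑ j ∈ range k, g j) * g k).im| ≤
      3 * ε * ((∑ j ∈ range n, ‖g j‖) * ‖g k‖) := by
    intro k hk
    have hk' := Finset.mem_range.1 hk
    have hP : ‖(∑ j ∈ range k, g j) - ((∑ j ∈ range k, ‖g j‖ : ℝ) : ℂ)‖ ≤
        ε * ∑ j ∈ range k, ‖g j‖ :=
      rsd_norm_sum_sub_le _ _ fun j hj => hg j ((Finset.mem_range.1 hj).trans hk')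
    have h := rsd_im_mul_conj_mul_sub_le (c := 1) (by simp)
      (Finset.sum_nonneg fun _ _ => norm_nonneg _) (norm_nonneg _) hε hε1 hP (hg k hk')
    simp only [one_mul, one_im, mul_zero, sub_zero] at h
    refine h.trans ?_
    have := hL k hk'
    have h3 : 0 ≤ 3 * ε := by linarith
    nlinarith [mul_le_mul_of_nonneg_right this (norm_nonneg (g k)), norm_nonneg (g k)]
  calc |∑ k ∈ range n, ((starRingEnd ℂ) (∑ j ∈ range k, g j) * g k).im|
      ≤ ∑ k ∈ range n, |((starRingEnd ℂ) (∑ j ∈ range k, g j) * g k).im| :=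
        Finset.abs_sum_le_sum_abs _ _
    _ ≤ ∑ k ∈ range n, 3 * ε * ((∑ j ∈ range n, ‖g j‖) * ‖g k‖) := Finset.sum_le_sum key
    _ = 3 * ε * (∑ k ∈ range n, ‖g k‖) ^ 2 := by
        rw [← Finset.mul_sum, ← Finset.mul_sum]; ring

/-- **Cross terms.** For `‖c‖ ≤ 1` and `D, D'` within relative `ε ≤ 1` of the non-negative reals
`ℓ, ℓ'`: `Im (c · conj D · D') ≤ ℓ ℓ' (Im c + 3ε)`. [folklore] -/
theorem rsd_cross_le {c D D' : ℂ} {ℓ ℓ' ε : ℝ} (hc : ‖c‖ ≤ 1) (hℓ : 0 ≤ ℓ) (hℓ' : 0 ≤ ℓ')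
    (hε : 0 ≤ ε) (hε1 : ε ≤ 1) (hD : ‖D - ℓ‖ ≤ ε * ℓ) (hD' : ‖D' - ℓ'‖ ≤ ε * ℓ') :
    (c * (starRingEnd ℂ) D * D').im ≤ ℓ * ℓ' * (c.im + 3 * ε) := by
  have h := rsd_im_mul_conj_mul_sub_le hc hℓ hℓ' hε hε1 hD hD'
  have := (abs_le.1 h).2
  nlinarith

/-! ### The boundary shoelace sum of the tile -/

/-- `Im (conj X · (X + g)) = Im (conj X · g)`. [folklore] -/
theorem rsd_im_conj_self_add (X g : ℂ) :
    ((starRingEnd ℂ) X * (X + g)).im = ((starRingEnd ℂ) X * g).im := by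
  rw [mul_add, add_im, ← Complex.normSq_eq_conj_mul_self, Complex.ofReal_im, zero_add]

/-- `Im (conj (X + g) · X) = - Im (conj X · g)`. [folklore] -/
theorem rsd_im_conj_add_self (X g : ℂ) :
    ((starRingEnd ℂ) (X + g) * X).im = -((starRingEnd ℂ) X * g).im := by
  rw [map_add, add_mul, add_im, ← Complex.normSq_eq_conj_mul_self, Complex.ofReal_im, zero_add,
    rsd_im_conj_mul_swap]

/-- `conj (ζ-1) · (ζ-1) = 1`. [folklore] -/
theorem rsd_conj_zsub_mul_zsub : (starRingEnd ℂ) (triZeta - 1) * (triZeta - 1) = 1 := by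
  rw [← Complex.normSq_eq_conj_mul_self, Complex.normSq_eq_norm_sq, rsd_norm_triZeta_sub_one]
  norm_num

/-- **Boundary bound.** The shoelace sum of the image of the tile boundary (bottom `→`, right `↑`
along `ζ²`, top `←`, left `↓`) is at most `(√3 + 18ε)(1+7ε)² ℓ_D²`. [folklore] -/
theorem rsd_boundary_le {G : Sym2 HexVertex → ℂ} {p : ℤ → ℤ → ℂ} {ε : ℝ} {a₀ b₀ : ℤ} {ρ : ℕ}
    (hH : ∀ a b : ℤ, b₀ ≤ b → b ≤ b₀ + ρ → a₀ + b₀ ≤ a + b → a + b < a₀ + b₀ + ρ →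
      p (a + 1) b - p a b = G s((![a, b], 0), (![a, b - 1], 1)))
    (hV : ∀ a b : ℤ, b₀ ≤ b → b < b₀ + ρ → a₀ + b₀ ≤ a + b → a + b < a₀ + b₀ + ρ →
      p a (b + 1) - p a b = triZeta * G s((![a, b], 0), (![a - 1, b], 1)))
    (hD : ∀ a b : ℤ, b₀ ≤ b → b < b₀ + ρ → a₀ + b₀ ≤ a + b + 1 → a + b + 1 ≤ a₀ + b₀ + ρ →
      p a (b + 1) - p (a + 1) b = (triZeta - 1) * G s((![a, b], 0), (![a, b], 1)))
    (hPC : ∀ a b : ℤ, b₀ ≤ b → b ≤ b₀ + ρ → a₀ + b₀ ≤ a + b → a + b < a₀ + b₀ + ρ →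
      ‖G s((![a, b], 0), (![a, b - 1], 1)) - ((‖G s((![a, b], 0), (![a, b - 1], 1))‖ : ℝ) : ℂ)‖ ≤ ε * ‖G s((![a, b], 0), (![a, b - 1], 1))‖)
    (hPB : ∀ a b : ℤ, b₀ ≤ b → b < b₀ + ρ → a₀ + b₀ ≤ a + b → a + b < a₀ + b₀ + ρ →
      ‖G s((![a, b], 0), (![a - 1, b], 1)) - ((‖G s((![a, b], 0), (![a - 1, b], 1))‖ : ℝ) : ℂ)‖ ≤ ε * ‖G s((![a, b], 0), (![a - 1, b], 1))‖)
    (hPA : ∀ a b : ℤ, b₀ ≤ b → b < b₀ + ρ → a₀ + b₀ ≤ a + b + 1 → a + b + 1 ≤ a₀ + b₀ + ρ →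
      ‖G s((![a, b], 0), (![a, b], 1)) - ((‖G s((![a, b], 0), (![a, b], 1))‖ : ℝ) : ℂ)‖ ≤ ε * ‖G s((![a, b], 0), (![a, b], 1))‖)
    (hε : 0 ≤ ε) (hε1 : ε ≤ 1 / 10) :
    (∑ s ∈ range ρ, ((starRingEnd ℂ) (p (a₀ + s - ((0 : ℕ) : ℤ)) (b₀ + ((0 : ℕ) : ℤ)) - p a₀ b₀) *
        (p (a₀ + ((s + 1 : ℕ) : ℤ) - ((0 : ℕ) : ℤ)) (b₀ + ((0 : ℕ) : ℤ)) - p a₀ b₀)).im) +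
    (∑ t ∈ range ρ, ((starRingEnd ℂ) (p (a₀ + ρ - t) (b₀ + t) - p a₀ b₀) *
        (p (a₀ + ρ - ((t + 1 : ℕ) : ℤ)) (b₀ + ((t + 1 : ℕ) : ℤ)) - p a₀ b₀)).im) +
    (∑ s ∈ range ρ, ((starRingEnd ℂ) (p (a₀ + ((s + 1 : ℕ) : ℤ) - ρ) (b₀ + ρ) - p a₀ b₀) *
        (p (a₀ + s - ρ) (b₀ + ρ) - p a₀ b₀)).im) +
    (∑ t ∈ range ρ, ((starRingEnd ℂ) (p (a₀ + ((0 : ℕ) : ℤ) - ((t + 1 : ℕ) : ℤ))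
        (b₀ + ((t + 1 : ℕ) : ℤ)) - p a₀ b₀) * (p (a₀ + ((0 : ℕ) : ℤ) - t) (b₀ + t) - p a₀ b₀)).im)
    ≤ (Real.sqrt 3 + 18 * ε) * (1 + 7 * ε) ^ 2 * (∑ k ∈ range ρ, ‖G s((![a₀, b₀ + k], 0), (![a₀ - 1, b₀ + k], 1))‖) ^ 2 := by
  have hρZ : (0 : ℤ) ≤ ρ := by exact_mod_cast Nat.zero_le ρ
  have hε1' : ε ≤ 1 := by linarith
  -- partial sums of the four step sequences as potential differences
  have ePB : ∀ s, s ≤ ρ → p (a₀ + s) b₀ - p a₀ b₀ = ∑ k ∈ range s, G s((![a₀ + k, b₀], 0), (![a₀ + k, b₀ - 1], 1)) := by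
    intro s hs
    have hsZ : (s : ℤ) ≤ ρ := by exact_mod_cast hs
    have := rsd_telescope (fun k : ℕ => p (a₀ + k) b₀) (fun k : ℕ => G s((![a₀ + k, b₀], 0), (![a₀ + k, b₀ - 1], 1))) 1 s
      (fun k hk => by
        have hkZ : (k : ℤ) < s := by exact_mod_cast hk
        have h := hH (a₀ + k) b₀ (by linarith) (by linarith) (by linarith) (by linarith)
        rw [one_mul, ← h]; push_cast; ring_nf)
    simpa using this
  have ePR : ∀ t, t ≤ ρ → p (a₀ + ρ - t) (b₀ + t) - p (a₀ + ρ) b₀ =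
      (triZeta - 1) * ∑ k ∈ range t, G s((![a₀ + ρ - k - 1, b₀ + k], 0), (![a₀ + ρ - k - 1, b₀ + k], 1)) := by
    intro t ht
    have htZ : (t : ℤ) ≤ ρ := by exact_mod_cast ht
    have := rsd_telescope (fun k : ℕ => p (a₀ + ρ - k) (b₀ + k))
      (fun k : ℕ => G s((![a₀ + ρ - k - 1, b₀ + k], 0), (![a₀ + ρ - k - 1, b₀ + k], 1))) (triZeta - 1) t (fun k hk => by
        have hkZ : (k : ℤ) < t := by exact_mod_cast hk
        have h := hD (a₀ + ρ - k - 1) (b₀ + k) (by linarith) (by linarith) (by linarith)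
          (by linarith)
        rw [← h]; push_cast; ring_nf)
    simpa using this
  have ePT : ∀ s, s ≤ ρ → p (a₀ + s - ρ) (b₀ + ρ) - p (a₀ - ρ) (b₀ + ρ) =
      ∑ k ∈ range s, G s((![a₀ + k - ρ, b₀ + ρ], 0), (![a₀ + k - ρ, b₀ + ρ - 1], 1)) := by
    intro s hs
    have hsZ : (s : ℤ) ≤ ρ := by exact_mod_cast hs
    have := rsd_telescope (fun k : ℕ => p (a₀ + k - ρ) (b₀ + ρ))
      (fun k : ℕ => G s((![a₀ + k - ρ, b₀ + ρ], 0), (![a₀ + k - ρ, b₀ + ρ - 1], 1))) 1 s (fun k hk => by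
        have hkZ : (k : ℤ) < s := by exact_mod_cast hk
        have h := hH (a₀ + k - ρ) (b₀ + ρ) (by linarith) (by linarith) (by linarith) (by linarith)
        rw [one_mul, ← h]; push_cast; ring_nf)
    simpa using this
  have ePL : ∀ t, t ≤ ρ → p (a₀ - t) (b₀ + t) - p a₀ b₀ =
      (triZeta - 1) * ∑ k ∈ range t, G s((![a₀ - k - 1, b₀ + k], 0), (![a₀ - k - 1, b₀ + k], 1)) := by
    intro t ht
    have htZ : (t : ℤ) ≤ ρ := by exact_mod_cast ht
    have := rsd_telescope (fun k : ℕ => p (a₀ - k) (b₀ + k))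
      (fun k : ℕ => G s((![a₀ - k - 1, b₀ + k], 0), (![a₀ - k - 1, b₀ + k], 1))) (triZeta - 1) t (fun k hk => by
        have hkZ : (k : ℤ) < t := by exact_mod_cast hk
        have h := hD (a₀ - k - 1) (b₀ + k) (by linarith) (by linarith) (by linarith) (by linarith)
        rw [← h]; push_cast; ring_nf)
    simpa using this
  -- the side sums and their lengths
  set DB := ∑ k ∈ range ρ, G s((![a₀ + k, b₀], 0), (![a₀ + k, b₀ - 1], 1)) with hDB
  set DR := ∑ k ∈ range ρ, G s((![a₀ + ρ - k - 1, b₀ + k], 0), (![a₀ + ρ - k - 1, b₀ + k], 1)) with hDR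
  set DT := ∑ k ∈ range ρ, G s((![a₀ + k - ρ, b₀ + ρ], 0), (![a₀ + k - ρ, b₀ + ρ - 1], 1)) with hDT
  set DL := ∑ k ∈ range ρ, G s((![a₀ - k - 1, b₀ + k], 0), (![a₀ - k - 1, b₀ + k], 1)) with hDL
  set lB := ∑ k ∈ range ρ, ‖G s((![a₀ + k, b₀], 0), (![a₀ + k, b₀ - 1], 1))‖ with hlB
  set lR := ∑ k ∈ range ρ, ‖G s((![a₀ + ρ - k - 1, b₀ + k], 0), (![a₀ + ρ - k - 1, b₀ + k], 1))‖ with hlR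
  set lT := ∑ k ∈ range ρ, ‖G s((![a₀ + k - ρ, b₀ + ρ], 0), (![a₀ + k - ρ, b₀ + ρ - 1], 1))‖ with hlT
  set lL := ∑ k ∈ range ρ, ‖G s((![a₀ - k - 1, b₀ + k], 0), (![a₀ - k - 1, b₀ + k], 1))‖ with hlL
  set lD := ∑ k ∈ range ρ, ‖G s((![a₀, b₀ + k], 0), (![a₀ - 1, b₀ + k], 1))‖ with hlD
  have pB : ∀ k, k < ρ → ‖G s((![a₀ + k, b₀], 0), (![a₀ + k, b₀ - 1], 1)) - ((‖G s((![a₀ + k, b₀], 0), (![a₀ + k, b₀ - 1], 1))‖ : ℝ) : ℂ)‖ ≤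
      ε * ‖G s((![a₀ + k, b₀], 0), (![a₀ + k, b₀ - 1], 1))‖ := fun k hk => by
    have hkZ : (k : ℤ) < ρ := by exact_mod_cast hk
    exact hPC _ _ (by linarith) (by linarith) (by linarith) (by linarith)
  have pR : ∀ k, k < ρ → ‖G s((![a₀ + ρ - k - 1, b₀ + k], 0), (![a₀ + ρ - k - 1, b₀ + k], 1)) - ((‖G s((![a₀ + ρ - k - 1, b₀ + k], 0), (![a₀ + ρ - k - 1, b₀ + k], 1))‖ : ℝ) : ℂ)‖ ≤
      ε * ‖G s((![a₀ + ρ - k - 1, b₀ + k], 0), (![a₀ + ρ - k - 1, b₀ + k], 1))‖ := fun k hk => by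
    have hkZ : (k : ℤ) < ρ := by exact_mod_cast hk
    exact hPA _ _ (by linarith) (by linarith) (by linarith) (by linarith)
  have pT : ∀ k, k < ρ → ‖G s((![a₀ + k - ρ, b₀ + ρ], 0), (![a₀ + k - ρ, b₀ + ρ - 1], 1)) - ((‖G s((![a₀ + k - ρ, b₀ + ρ], 0), (![a₀ + k - ρ, b₀ + ρ - 1], 1))‖ : ℝ) : ℂ)‖ ≤
      ε * ‖G s((![a₀ + k - ρ, b₀ + ρ], 0), (![a₀ + k - ρ, b₀ + ρ - 1], 1))‖ := fun k hk => by
    have hkZ : (k : ℤ) < ρ := by exact_mod_cast hk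
    exact hPC _ _ (by linarith) (by linarith) (by linarith) (by linarith)
  have pL : ∀ k, k < ρ → ‖G s((![a₀ - k - 1, b₀ + k], 0), (![a₀ - k - 1, b₀ + k], 1)) - ((‖G s((![a₀ - k - 1, b₀ + k], 0), (![a₀ - k - 1, b₀ + k], 1))‖ : ℝ) : ℂ)‖ ≤
      ε * ‖G s((![a₀ - k - 1, b₀ + k], 0), (![a₀ - k - 1, b₀ + k], 1))‖ := fun k hk => by
    have hkZ : (k : ℤ) < ρ := by exact_mod_cast hk
    exact hPA _ _ (by linarith) (by linarith) (by linarith) (by linarith)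
  have nB : ‖DB - lB‖ ≤ ε * lB := rsd_norm_sum_sub_le _ _ fun k hk => pB k (Finset.mem_range.1 hk)
  have nR : ‖DR - lR‖ ≤ ε * lR := rsd_norm_sum_sub_le _ _ fun k hk => pR k (Finset.mem_range.1 hk)
  have nT : ‖DT - lT‖ ≤ ε * lT := rsd_norm_sum_sub_le _ _ fun k hk => pT k (Finset.mem_range.1 hk)
  have nL : ‖DL - lL‖ ≤ ε * lL := rsd_norm_sum_sub_le _ _ fun k hk => pL k (Finset.mem_range.1 hk)
  have lB0 : 0 ≤ lB := Finset.sum_nonneg fun _ _ => norm_nonneg _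
  have lR0 : 0 ≤ lR := Finset.sum_nonneg fun _ _ => norm_nonneg _
  have lT0 : 0 ≤ lT := Finset.sum_nonneg fun _ _ => norm_nonneg _
  have lL0 : 0 ≤ lL := Finset.sum_nonneg fun _ _ => norm_nonneg _
  have lD0 : 0 ≤ lD := Finset.sum_nonneg fun _ _ => norm_nonneg _
  obtain ⟨sB, sR, sT, sL⟩ := rsd_sides hH hV hD hPC hPB hPA hε hε1
  have uB : lB ≤ (1 + 7 * ε) * lD := by have := (abs_le.1 sB).2; linarith
  have uR : lR ≤ (1 + 7 * ε) * lD := by have := (abs_le.1 sR).2; linarith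
  have uT : lT ≤ (1 + 7 * ε) * lD := by have := (abs_le.1 sT).2; linarith
  have uL : lL ≤ (1 + 7 * ε) * lD := by have := (abs_le.1 sL).2; linarith
  -- bottom
  have eBot : ∀ s ∈ range ρ,
      ((starRingEnd ℂ) (p (a₀ + s - ((0 : ℕ) : ℤ)) (b₀ + ((0 : ℕ) : ℤ)) - p a₀ b₀) *
        (p (a₀ + ((s + 1 : ℕ) : ℤ) - ((0 : ℕ) : ℤ)) (b₀ + ((0 : ℕ) : ℤ)) - p a₀ b₀)).im =
      ((starRingEnd ℂ) (∑ j ∈ range s, G s((![a₀ + j, b₀], 0), (![a₀ + j, b₀ - 1], 1))) * G s((![a₀ + s, b₀], 0), (![a₀ + s, b₀ - 1], 1))).im := by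
    intro s hs
    have hs' := Finset.mem_range.1 hs
    have e1 : p (a₀ + s - ((0 : ℕ) : ℤ)) (b₀ + ((0 : ℕ) : ℤ)) - p a₀ b₀ =
        ∑ j ∈ range s, G s((![a₀ + j, b₀], 0), (![a₀ + j, b₀ - 1], 1)) := by
      rw [← ePB s hs'.le]; simp
    have e2 : p (a₀ + ((s + 1 : ℕ) : ℤ) - ((0 : ℕ) : ℤ)) (b₀ + ((0 : ℕ) : ℤ)) - p a₀ b₀ =
        (∑ j ∈ range s, G s((![a₀ + j, b₀], 0), (![a₀ + j, b₀ - 1], 1))) + G s((![a₀ + s, b₀], 0), (![a₀ + s, b₀ - 1], 1)) := by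
      rw [← Finset.sum_range_succ, ← ePB (s + 1) hs']; simp
    rw [e1, e2, rsd_im_conj_self_add]
  -- right
  have eRight : ∀ t ∈ range ρ,
      ((starRingEnd ℂ) (p (a₀ + ρ - t) (b₀ + t) - p a₀ b₀) *
        (p (a₀ + ρ - ((t + 1 : ℕ) : ℤ)) (b₀ + ((t + 1 : ℕ) : ℤ)) - p a₀ b₀)).im =
      ((triZeta - 1) * (starRingEnd ℂ) DB * G s((![a₀ + ρ - t - 1, b₀ + t], 0), (![a₀ + ρ - t - 1, b₀ + t], 1))).im +
        ((starRingEnd ℂ) (∑ j ∈ range t, G s((![a₀ + ρ - j - 1, b₀ + j], 0), (![a₀ + ρ - j - 1, b₀ + j], 1))) *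
          G s((![a₀ + ρ - t - 1, b₀ + t], 0), (![a₀ + ρ - t - 1, b₀ + t], 1))).im := by
    intro t ht
    have ht' := Finset.mem_range.1 ht
    have e0 := ePB ρ le_rfl
    have f1 := ePR t ht'.le
    have f2 := ePR (t + 1) ht'
    rw [Finset.sum_range_succ, mul_add] at f2
    have e1 : p (a₀ + ρ - t) (b₀ + t) - p a₀ b₀ =
        DB + (triZeta - 1) * ∑ j ∈ range t, G s((![a₀ + ρ - j - 1, b₀ + j], 0), (![a₀ + ρ - j - 1, b₀ + j], 1)) := by
      rw [hDB]; linear_combination f1 + e0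
    have e2 : p (a₀ + ρ - ((t + 1 : ℕ) : ℤ)) (b₀ + ((t + 1 : ℕ) : ℤ)) - p a₀ b₀ =
        (DB + (triZeta - 1) * ∑ j ∈ range t, G s((![a₀ + ρ - j - 1, b₀ + j], 0), (![a₀ + ρ - j - 1, b₀ + j], 1))) +
          (triZeta - 1) * G s((![a₀ + ρ - t - 1, b₀ + t], 0), (![a₀ + ρ - t - 1, b₀ + t], 1)) := by
      rw [hDB]; linear_combination f2 + e0
    rw [e1, e2, rsd_im_conj_self_add]
    have : (starRingEnd ℂ) (DB + (triZeta - 1) * ∑ j ∈ range t, G s((![a₀ + ρ - j - 1, b₀ + j], 0), (![a₀ + ρ - j - 1, b₀ + j], 1))) *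
        ((triZeta - 1) * G s((![a₀ + ρ - t - 1, b₀ + t], 0), (![a₀ + ρ - t - 1, b₀ + t], 1))) =
        (triZeta - 1) * (starRingEnd ℂ) DB * G s((![a₀ + ρ - t - 1, b₀ + t], 0), (![a₀ + ρ - t - 1, b₀ + t], 1)) +
        (starRingEnd ℂ) (∑ j ∈ range t, G s((![a₀ + ρ - j - 1, b₀ + j], 0), (![a₀ + ρ - j - 1, b₀ + j], 1))) *
          G s((![a₀ + ρ - t - 1, b₀ + t], 0), (![a₀ + ρ - t - 1, b₀ + t], 1)) := by
      rw [map_add, map_mul]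
      linear_combination ((starRingEnd ℂ) (∑ j ∈ range t, G s((![a₀ + ρ - j - 1, b₀ + j], 0), (![a₀ + ρ - j - 1, b₀ + j], 1))) *
        G s((![a₀ + ρ - t - 1, b₀ + t], 0), (![a₀ + ρ - t - 1, b₀ + t], 1))) * rsd_conj_zsub_mul_zsub
    rw [this, add_im]
  -- top
  have eTop : ∀ s ∈ range ρ,
      ((starRingEnd ℂ) (p (a₀ + ((s + 1 : ℕ) : ℤ) - ρ) (b₀ + ρ) - p a₀ b₀) *
        (p (a₀ + s - ρ) (b₀ + ρ) - p a₀ b₀)).im =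
      ((-(starRingEnd ℂ) (triZeta - 1)) * (starRingEnd ℂ) DL * G s((![a₀ + s - ρ, b₀ + ρ], 0), (![a₀ + s - ρ, b₀ + ρ - 1], 1))).im -
        ((starRingEnd ℂ) (∑ j ∈ range s, G s((![a₀ + j - ρ, b₀ + ρ], 0), (![a₀ + j - ρ, b₀ + ρ - 1], 1))) * G s((![a₀ + s - ρ, b₀ + ρ], 0), (![a₀ + s - ρ, b₀ + ρ - 1], 1))).im := by
    intro s hs
    have hs' := Finset.mem_range.1 hs
    have e0 := ePL ρ le_rfl
    have f1 := ePT s hs'.le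
    have f2 := ePT (s + 1) hs'
    rw [Finset.sum_range_succ] at f2
    have e1 : p (a₀ + s - ρ) (b₀ + ρ) - p a₀ b₀ =
        (triZeta - 1) * DL + ∑ j ∈ range s, G s((![a₀ + j - ρ, b₀ + ρ], 0), (![a₀ + j - ρ, b₀ + ρ - 1], 1)) := by
      rw [hDL]; linear_combination f1 + e0
    have e2 : p (a₀ + ((s + 1 : ℕ) : ℤ) - ρ) (b₀ + ρ) - p a₀ b₀ =
        ((triZeta - 1) * DL + ∑ j ∈ range s, G s((![a₀ + j - ρ, b₀ + ρ], 0), (![a₀ + j - ρ, b₀ + ρ - 1], 1))) + G s((![a₀ + s - ρ, b₀ + ρ], 0), (![a₀ + s - ρ, b₀ + ρ - 1], 1)) := by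
      rw [hDL]; linear_combination f2 + e0
    rw [e1, e2, rsd_im_conj_add_self]
    have : (starRingEnd ℂ) ((triZeta - 1) * DL + ∑ j ∈ range s, G s((![a₀ + j - ρ, b₀ + ρ], 0), (![a₀ + j - ρ, b₀ + ρ - 1], 1))) *
        G s((![a₀ + s - ρ, b₀ + ρ], 0), (![a₀ + s - ρ, b₀ + ρ - 1], 1)) =
        -((-(starRingEnd ℂ) (triZeta - 1)) * (starRingEnd ℂ) DL * G s((![a₀ + s - ρ, b₀ + ρ], 0), (![a₀ + s - ρ, b₀ + ρ - 1], 1))) +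
        (starRingEnd ℂ) (∑ j ∈ range s, G s((![a₀ + j - ρ, b₀ + ρ], 0), (![a₀ + j - ρ, b₀ + ρ - 1], 1))) * G s((![a₀ + s - ρ, b₀ + ρ], 0), (![a₀ + s - ρ, b₀ + ρ - 1], 1)) := by
      rw [map_add, map_mul]; ring
    rw [this, add_im, neg_im]
    ring
  -- left
  have eLeft : ∀ t ∈ range ρ,
      ((starRingEnd ℂ) (p (a₀ + ((0 : ℕ) : ℤ) - ((t + 1 : ℕ) : ℤ)) (b₀ + ((t + 1 : ℕ) : ℤ)) - p a₀ b₀) *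
        (p (a₀ + ((0 : ℕ) : ℤ) - t) (b₀ + t) - p a₀ b₀)).im =
      -((starRingEnd ℂ) (∑ j ∈ range t, G s((![a₀ - j - 1, b₀ + j], 0), (![a₀ - j - 1, b₀ + j], 1))) * G s((![a₀ - t - 1, b₀ + t], 0), (![a₀ - t - 1, b₀ + t], 1))).im := by
    intro t ht
    have ht' := Finset.mem_range.1 ht
    have f1 := ePL t ht'.le
    have f2 := ePL (t + 1) ht'
    rw [Finset.sum_range_succ, mul_add] at f2
    have e1 : p (a₀ + ((0 : ℕ) : ℤ) - t) (b₀ + t) - p a₀ b₀ =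
        (triZeta - 1) * ∑ j ∈ range t, G s((![a₀ - j - 1, b₀ + j], 0), (![a₀ - j - 1, b₀ + j], 1)) := by
      rw [← f1]; simp
    have e2 : p (a₀ + ((0 : ℕ) : ℤ) - ((t + 1 : ℕ) : ℤ)) (b₀ + ((t + 1 : ℕ) : ℤ)) - p a₀ b₀ =
        (triZeta - 1) * ∑ j ∈ range t, G s((![a₀ - j - 1, b₀ + j], 0), (![a₀ - j - 1, b₀ + j], 1)) +
          (triZeta - 1) * G s((![a₀ - t - 1, b₀ + t], 0), (![a₀ - t - 1, b₀ + t], 1)) := by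
      rw [← f2]; simp
    rw [e1, e2, rsd_im_conj_add_self]
    have : (starRingEnd ℂ) ((triZeta - 1) * ∑ j ∈ range t, G s((![a₀ - j - 1, b₀ + j], 0), (![a₀ - j - 1, b₀ + j], 1))) *
        ((triZeta - 1) * G s((![a₀ - t - 1, b₀ + t], 0), (![a₀ - t - 1, b₀ + t], 1))) =
        (starRingEnd ℂ) (∑ j ∈ range t, G s((![a₀ - j - 1, b₀ + j], 0), (![a₀ - j - 1, b₀ + j], 1))) * G s((![a₀ - t - 1, b₀ + t], 0), (![a₀ - t - 1, b₀ + t], 1)) := by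
      rw [map_mul]
      linear_combination ((starRingEnd ℂ) (∑ j ∈ range t, G s((![a₀ - j - 1, b₀ + j], 0), (![a₀ - j - 1, b₀ + j], 1))) *
        G s((![a₀ - t - 1, b₀ + t], 0), (![a₀ - t - 1, b₀ + t], 1))) * rsd_conj_zsub_mul_zsub
    rw [this]
  rw [Finset.sum_congr rfl eBot, Finset.sum_congr rfl eRight, Finset.sum_congr rfl eTop,
    Finset.sum_congr rfl eLeft, Finset.sum_add_distrib, Finset.sum_sub_distrib,
    Finset.sum_neg_distrib]
  -- cross sums
  have cR : ∑ t ∈ range ρ, ((triZeta - 1) * (starRingEnd ℂ) DB * G s((![a₀ + ρ - t - 1, b₀ + t], 0), (![a₀ + ρ - t - 1, b₀ + t], 1))).im =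
      ((triZeta - 1) * (starRingEnd ℂ) DB * DR).im := by
    rw [hDR, Finset.mul_sum, Complex.im_sum]
  have cT : ∑ s ∈ range ρ, ((-(starRingEnd ℂ) (triZeta - 1)) * (starRingEnd ℂ) DL *
      G s((![a₀ + s - ρ, b₀ + ρ], 0), (![a₀ + s - ρ, b₀ + ρ - 1], 1))).im = ((-(starRingEnd ℂ) (triZeta - 1)) * (starRingEnd ℂ) DL * DT).im := by
    rw [hDT, Finset.mul_sum, Complex.im_sum]
  rw [cR, cT]
  -- estimates
  have xR := rsd_cross_le (c := triZeta - 1) (le_of_eq rsd_norm_triZeta_sub_one) lB0 lR0 hε hε1'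
    nB nR
  have hc2 : ‖-(starRingEnd ℂ) (triZeta - 1)‖ ≤ 1 := by
    rw [norm_neg, Complex.norm_conj, rsd_norm_triZeta_sub_one]
  have xT := rsd_cross_le hc2 lL0 lT0 hε hε1' nL nT
  rw [rsd_im_triZeta_sub_one] at xR
  have imc2 : (-(starRingEnd ℂ) (triZeta - 1)).im = Real.sqrt 3 / 2 := by simp
  rw [imc2] at xT
  have aB := (abs_le.1 (rsd_side_self_le (fun k => G s((![a₀ + k, b₀], 0), (![a₀ + k, b₀ - 1], 1))) ρ hε hε1' pB)).2
  have aR := (abs_le.1 (rsd_side_self_le (fun k => G s((![a₀ + ρ - k - 1, b₀ + k], 0), (![a₀ + ρ - k - 1, b₀ + k], 1))) ρ hε hε1' pR)).2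
  have aT := (abs_le.1 (rsd_side_self_le (fun k => G s((![a₀ + k - ρ, b₀ + ρ], 0), (![a₀ + k - ρ, b₀ + ρ - 1], 1))) ρ hε hε1' pT)).1
  have aL := (abs_le.1 (rsd_side_self_le (fun k => G s((![a₀ - k - 1, b₀ + k], 0), (![a₀ - k - 1, b₀ + k], 1))) ρ hε hε1' pL)).1
  have hs3 : (1.7 : ℝ) ≤ Real.sqrt 3 := by
    rw [Real.le_sqrt (by norm_num) (by norm_num)]; norm_num
  have hpos : 0 ≤ Real.sqrt 3 / 2 + 3 * ε := by linarith
  have h3e : 0 ≤ 3 * ε := by linarith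
  have pBR : lB * lR ≤ ((1 + 7 * ε) * lD) * ((1 + 7 * ε) * lD) := mul_le_mul uB uR lR0 (by positivity)
  have pLT : lL * lT ≤ ((1 + 7 * ε) * lD) * ((1 + 7 * ε) * lD) := mul_le_mul uL uT lT0 (by positivity)
  have pBB : lB * lB ≤ ((1 + 7 * ε) * lD) * ((1 + 7 * ε) * lD) := mul_le_mul uB uB lB0 (by positivity)
  have pRR : lR * lR ≤ ((1 + 7 * ε) * lD) * ((1 + 7 * ε) * lD) := mul_le_mul uR uR lR0 (by positivity)
  have pTT : lT * lT ≤ ((1 + 7 * ε) * lD) * ((1 + 7 * ε) * lD) := mul_le_mul uT uT lT0 (by positivity)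
  have pLL : lL * lL ≤ ((1 + 7 * ε) * lD) * ((1 + 7 * ε) * lD) := mul_le_mul uL uL lL0 (by positivity)
  have q1 := mul_le_mul_of_nonneg_left (add_le_add pBR pLT) hpos
  have q2 := mul_le_mul_of_nonneg_left (add_le_add (add_le_add (add_le_add pBB pRR) pTT) pLL) h3e
  have e_fin : (Real.sqrt 3 / 2 + 3 * ε) * (((1 + 7 * ε) * lD) * ((1 + 7 * ε) * lD) +
      ((1 + 7 * ε) * lD) * ((1 + 7 * ε) * lD)) +
      3 * ε * (((1 + 7 * ε) * lD) * ((1 + 7 * ε) * lD) + ((1 + 7 * ε) * lD) * ((1 + 7 * ε) * lD) +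
        ((1 + 7 * ε) * lD) * ((1 + 7 * ε) * lD) + ((1 + 7 * ε) * lD) * ((1 + 7 * ε) * lD)) =
      (Real.sqrt 3 + 18 * ε) * (1 + 7 * ε) ^ 2 * lD ^ 2 := by ring
  have sq_eq : ∀ x : ℝ, x ^ 2 = x * x := fun x => sq x
  rw [sq_eq] at aB aR aT aL
  linarith [xR, xT, aB, aR, aT, aL, q1, q2, e_fin]

end Summit.CriticalPhenomena.SAWScalingLimit.Theorems
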